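import Mathlib
import HarnessLib
import Summits.Ventures.LatticeQCDFlow.Scaling.AutoregressivePathFaithful

/-!
# LatticeQCDFlow / Scaling — strictly TP₂ bonds along an integrated path ARE read through the block;
# the downward path of the ring `ℤ/(n+2)` (bookkeeping for the ring theorem)

HONEST FRAMING: exact (Metropolis-corrected) sampling algorithms for lattice gauge theory;
figures of merit are autocorrelation/cost numbers at stated couplings and volumes; no
continuum-physics claim.

Venture `LatticeQCDFlow` (cell pub-lqcd), topic `Scaling`, FANOUT row 30 (lean-1, GEN-17) — OUR WORK on
THEORY-2.md §4 conjecture C5, assembling `Scaling/KernelCompositionTP2` (strict total positivity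
survives composition) and `Scaling/AutoregressivePathFaithful` (blind ⇒ composed kernel of product
form; the path factor integrates to the composed kernel):

* §1 **`arConditional_reads_through_path`** (any finite index set; `X` linearly ordered with a
  reference probability measure seeing two comparable points): if the weight sorts as
  `(path factor from a through distinct integrated sites p₁…p_k to the retained j) · w₁ · w₂` with
  strictly TP₂ positive bounded measurable bonds along the path, positive bounded measurable site
  weights, `w₁` blind to `j` and the path, `w₂` blind to `a` and the block, then the exact conditional
  of `a` READS `j`: two configurations agreeing off `j` have different `A_s w / A_{insert a s} w`.
* §2 the ring `ℤ/(n+2)` (sites `Fin (n+2)`, chain bonds `b_l` between `l` and `l+1`, closing bond `bc`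
  between the last site and `0`, site factors `g_i`): the downward bond `ringDown` out of a site, the
  downward path `ringPath m = [(m−1, g_{m−1}, ringDown (m−1)), …, (0, g_0, ringDown 0)]`, its sites
  (`mem_ringPath_sites_iff`: exactly the sites `< m`; `ringPath_sites_nodup`), and
  **`pathFactor_ringPath`**: the path factor of the downward path at the current value `η m` is
  `bc(η last, η 0) · ∏_{i<m} g_i(η i) · ∏_{l<m} b_l(η l, η (l+1))` — exactly the terms of the ring
  weight touching the block `{0,…,m−1}`; `ringDown_props` (strict TP₂ / positivity / bounds /
  measurability of the downward bonds from those of `b`, `bc`).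
The ring theorem itself (`ring_arConditional_reads_last`) is the sequel `Scaling/AutoregressiveRingFaithful`.

NOT CLAIMED: `d ≥ 2`; non-TP₂ bonds.  Elementary over the parents; `def ringDown`, `def ringPath`
(bookkeeping); nothing is cited as a fact; no `sorry`.
-/

noncomputable section

namespace Summit.Ventures.LatticeQCDFlow.Theory2.Autoregressive

open MeasureTheory Function Set
open Summit.Ventures.LatticeQCDFlow.Exactness

variable {ι : Type*} [Fintype ι] [DecidableEq ι]
variable {X : Type*} [MeasurableSpace X]
variable (μ : Measure X) [IsProbabilityMeasure μ]

/-! ## §1 Strictly TP₂ bonds along an integrated path ⇒ the conditional reads the far end -/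

/-- **A RETAINED VARIABLE REACHED THROUGH AN INTEGRATED PATH OF STRICTLY TP₂ BONDS IS READ.**
`w = f₀ · w₁ · w₂` with `f₀ η = pathFactor F path j (η a) η` (bond `F` out of `a`, then site weights and
onward bonds through the distinct integrated sites of `path`, ending at the retained `j`); `w₁` reads
only `V₁ ∌ j` disjoint from the path; `w₂` reads only `V₂ ∌ a` disjoint from `s`; `w₂ ≠ 0`,
`A_s w₁ ≠ 0`, `A_{insert a s} w ≠ 0`; `F` and the onward bonds strictly TP₂, positive, bounded, jointly
measurable; site weights positive bounded measurable; `0 < (μ ⊗ μ){x < y}`.  Then there are two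
configurations agreeing off `j` with different exact conditionals of `a`. [ours] -/
theorem arConditional_reads_through_path [LinearOrder X] (s : Finset ι) {a j : ι} (has : a ∉ s)
    (hjs : j ∉ s) (hja : j ≠ a) (F : X → X → ℝ) (path : List (ι × (X → ℝ) × (X → X → ℝ)))
    (hnd : (path.map Prod.fst).Nodup) (hps : ∀ p ∈ path.map Prod.fst, p ∈ s)
    {w₁ w₂ : (ι → X) → ℝ} {V₁ V₂ : Set ι}
    (hw₁ : DependsOn w₁ V₁) (hjV₁ : j ∉ V₁) (hTV₁ : ∀ p ∈ path.map Prod.fst, p ∉ V₁)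
    (hw₂ : DependsOn w₂ V₂) (haV₂ : a ∉ V₂) (hsV₂ : ∀ i ∈ s, i ∉ V₂)
    (hw₂ne : ∀ ψ, w₂ ψ ≠ 0) (hG : ∀ ψ, coordAvg μ s w₁ ψ ≠ 0)
    (hM : ∀ ψ, coordAvg μ (insert a s)
      (fun η => pathFactor F path j (η a) η * w₁ η * w₂ η) ψ ≠ 0)
    (hμ : 0 < (μ.prod μ) {p : X × X | p.1 < p.2})
    (hFp : ∀ u x, 0 < F u x) (hFm : Measurable (uncurry F)) (hFb : ∃ C, ∀ u x, |F u x| ≤ C)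
    (hFs : ∀ u u' x y, u < u' → x < y → F u y * F u' x < F u x * F u' y)
    (hg : ∀ pgb ∈ path, (∀ x, 0 < pgb.2.1 x) ∧ Measurable pgb.2.1 ∧ ∃ C, ∀ x, |pgb.2.1 x| ≤ C)
    (hb : ∀ pgb ∈ path, (∀ x t, 0 < pgb.2.2 x t) ∧ Measurable (uncurry pgb.2.2) ∧
      (∃ C, ∀ x t, |pgb.2.2 x t| ≤ C) ∧
      ∀ x y t t', x < y → t < t' → pgb.2.2 x t' * pgb.2.2 y t < pgb.2.2 x t * pgb.2.2 y t') :
    ∃ ψ ψ' : ι → X, (∀ i, i ≠ j → ψ i = ψ' i) ∧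
      coordAvg μ s (fun η => pathFactor F path j (η a) η * w₁ η * w₂ η) ψ /
          coordAvg μ (insert a s) (fun η => pathFactor F path j (η a) η * w₁ η * w₂ η) ψ ≠
        coordAvg μ s (fun η => pathFactor F path j (η a) η * w₁ η * w₂ η) ψ' /
          coordAvg μ (insert a s) (fun η => pathFactor F path j (η a) η * w₁ η * w₂ η) ψ' := by
  classical
  obtain ⟨x₀, -, -⟩ := exists_lt_of_prod_lt_pos hμ
  let φ : ι → X := fun _ => x₀
  -- what the path factor reads
  have hf₀ : DependsOn (fun η : ι → X => pathFactor F path j (η a) η)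
      (insert a (insert j {i | i ∈ path.map Prod.fst})) := by
    intro η η' h
    have ha' : η a = η' a := h a (Set.mem_insert _ _)
    simp only [ha']
    exact dependsOn_pathFactor path j F (η' a) fun i hi => h i (Set.mem_insert_of_mem _ hi)
  have ha_np : a ∉ path.map Prod.fst := fun h => has (hps a h)
  have hj_np : j ∉ path.map Prod.fst := fun h => hjs (hps j h)
  -- the composed kernel is the path kernel of `KernelCompositionTP2`
  have hK : ∀ v r, coordAvg μ s (fun η => pathFactor F path j (η a) η) (update (update φ a v) j r) =
      pathKernel μ F (path.map Prod.snd) v r := by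
    intro v r
    rw [coordAvg_eq_of_reads μ s (path.map Prod.fst).toFinset (fun p hp => hps p (by simpa using hp))
      hf₀ ?_]
    · rw [coordAvg_pathFactor μ path hnd ha_np hj_np (fun q hq => (hg q hq).2)
        (fun q hq => ⟨(hb q hq).2.1, (hb q hq).2.2.1⟩) F hFm hFb]
      rw [update_self, update_of_ne hja.symm, update_self]
    · intro i hi hiV
      rcases Set.mem_insert_iff.1 hiV with rfl | hiV
      · exact absurd hi has
      rcases Set.mem_insert_iff.1 hiV with rfl | hiT
      · exact absurd hi hjs
      · simpa using hiT
  have hg' : ∀ gb ∈ path.map Prod.snd, (∀ x, 0 < gb.1 x) ∧ Measurable gb.1 ∧ ∃ C, ∀ x, |gb.1 x| ≤ C := by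
    intro gb hgb
    obtain ⟨pgb, hp, rfl⟩ := List.mem_map.1 hgb
    exact hg pgb hp
  have hb' : ∀ gb ∈ path.map Prod.snd, (∀ x t, 0 < gb.2 x t) ∧ Measurable (uncurry gb.2) ∧
      (∃ C, ∀ x t, |gb.2 x t| ≤ C) ∧
      ∀ x y t t', x < y → t < t' → gb.2 x t' * gb.2 y t < gb.2 x t * gb.2 y t' := by
    intro gb hgb
    obtain ⟨pgb, hp, rfl⟩ := List.mem_map.1 hgb
    exact hb pgb hp
  obtain ⟨u, u', t, t', hne⟩ :=
    pathKernel_not_productForm μ hμ (path.map Prod.snd) hg' hb' hFp hFm hFb hFs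
  refine arConditional_reads_path μ s has hjs hja hf₀ hw₁ hjV₁ (fun i hi => hTV₁ i hi) hw₂ haV₂ hsV₂
    hw₂ne hG hM (φ := φ) (u := u) (u' := u') (t := t) (t' := t') ?_
  rw [hK, hK, hK, hK]
  exact hne

/-! ## §2 The ring `ℤ/(n+2)`: bookkeeping of the downward path `k−1, …, 0, last` -/

section Ring

variable {n : ℕ}

/-- The onward (downward) bond out of site `i` of the ring, as a kernel (value at `i`, value at the
next site down): from `0` the closing bond to the last site, from `i ≥ 1` the chain bond `b_{i−1}`
traversed backwards. [ours] -/
def ringDown (b : Fin (n + 1) → X → X → ℝ) (bc : X → X → ℝ) (i : Fin (n + 2)) : X → X → ℝ :=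
  if h : i = 0 then fun x y => bc y x else fun x y => b (i.pred h) y x

/-- The downward path of the ring below site `m`: entries `(i, g_i, ringDown i)` for
`i = m−1, …, 0`. [ours] -/
def ringPath (g : Fin (n + 2) → X → ℝ) (b : Fin (n + 1) → X → X → ℝ) (bc : X → X → ℝ) :
    (m : ℕ) → m ≤ n + 2 → List (Fin (n + 2) × (X → ℝ) × (X → X → ℝ))
  | 0, _ => []
  | m + 1, hm => (⟨m, by omega⟩, g ⟨m, by omega⟩, ringDown b bc ⟨m, by omega⟩) ::
      ringPath g b bc m (by omega)

variable (g : Fin (n + 2) → X → ℝ) (b : Fin (n + 1) → X → X → ℝ) (bc : X → X → ℝ)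

omit [MeasurableSpace X] in
/-- The entries of the downward path. [ours] -/
theorem mem_ringPath_iff (m : ℕ) (hm : m ≤ n + 2) (pgb : Fin (n + 2) × (X → ℝ) × (X → X → ℝ)) :
    pgb ∈ ringPath g b bc m hm ↔ ∃ i : Fin (n + 2), i.val < m ∧ pgb = (i, g i, ringDown b bc i) := by
  induction m with
  | zero => simp [ringPath]
  | succ m ih =>
    simp only [ringPath, List.mem_cons, ih (by omega)]
    constructor
    · rintro (rfl | ⟨i, hi, rfl⟩)
      · exact ⟨⟨m, by omega⟩, by simp, rfl⟩
      · exact ⟨i, by omega, rfl⟩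
    · rintro ⟨⟨i, hi'⟩, hi, rfl⟩
      by_cases him : i = m
      · subst him; exact Or.inl rfl
      · exact Or.inr ⟨⟨i, hi'⟩, by simp only at hi ⊢; omega, rfl⟩

omit [MeasurableSpace X] in
/-- The sites of the downward path below `m` are exactly the sites `< m`. [ours] -/
theorem mem_ringPath_sites_iff (m : ℕ) (hm : m ≤ n + 2) (p : Fin (n + 2)) :
    p ∈ (ringPath g b bc m hm).map Prod.fst ↔ p.val < m := by
  rw [List.mem_map]
  constructor
  · rintro ⟨pgb, hp, rfl⟩
    obtain ⟨i, hi, rfl⟩ := (mem_ringPath_iff g b bc m hm pgb).1 hp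
    exact hi
  · intro hp
    exact ⟨(p, g p, ringDown b bc p), (mem_ringPath_iff g b bc m hm _).2 ⟨p, hp, rfl⟩, rfl⟩

omit [MeasurableSpace X] in
/-- The sites of the downward path are distinct. [ours] -/
theorem ringPath_sites_nodup (m : ℕ) (hm : m ≤ n + 2) : ((ringPath g b bc m hm).map Prod.fst).Nodup := by
  induction m with
  | zero => simp [ringPath]
  | succ m ih =>
    simp only [ringPath, List.map_cons, List.nodup_cons]
    refine ⟨fun h => ?_, ih (by omega)⟩
    have := (mem_ringPath_sites_iff g b bc m (by omega) _).1 h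
    simp at this

omit [MeasurableSpace X] in
/-- Splitting a product over `Fin N` at the indices `< m`, then at one more index. [ours] -/
theorem prod_filter_val_lt_succ {N : ℕ} (f : Fin N → ℝ) (m : ℕ) (hm : m < N) :
    ∏ i ∈ Finset.univ.filter (fun i : Fin N => i.val < m + 1), f i =
      (∏ i ∈ Finset.univ.filter (fun i : Fin N => i.val < m), f i) * f ⟨m, hm⟩ := by
  have hset : Finset.univ.filter (fun i : Fin N => i.val < m + 1) =
      insert ⟨m, hm⟩ (Finset.univ.filter fun i : Fin N => i.val < m) := by
    ext i
    simp only [Finset.mem_filter, Finset.mem_univ, true_and, Finset.mem_insert, Fin.ext_iff]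
    omega
  rw [hset, Finset.prod_insert (by simp), mul_comm]

omit [MeasurableSpace X] in
/-- **The path factor of the downward path is the product of the terms touching the block**: at the
current value `η m`, `pathFactor (ringDown m) (ringPath m) last (η m) η =
bc(η last, η 0) · ∏_{i<m} g_i(η i) · ∏_{l<m} b_l(η l, η (l+1))`. [ours] -/
theorem pathFactor_ringPath (m : ℕ) (hm : m ≤ n + 1) (η : Fin (n + 2) → X) :
    pathFactor (ringDown b bc ⟨m, by omega⟩) (ringPath g b bc m (by omega)) (Fin.last (n + 1))
        (η ⟨m, by omega⟩) η =
      bc (η (Fin.last (n + 1))) (η 0) *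
        (∏ i ∈ Finset.univ.filter (fun i : Fin (n + 2) => i.val < m), g i (η i)) *
        ∏ l ∈ Finset.univ.filter (fun l : Fin (n + 1) => l.val < m), b l (η l.castSucc) (η l.succ) := by
  induction m with
  | zero =>
    have h0 : (⟨0, by omega⟩ : Fin (n + 2)) = 0 := rfl
    simp [ringPath, pathFactor, ringDown, h0]
  | succ m ih =>
    rw [ringPath, pathFactor_cons]
    simp only
    rw [ih (by omega), prod_filter_val_lt_succ _ m (by omega), prod_filter_val_lt_succ _ m (by omega)]
    have hne : (⟨m + 1, by omega⟩ : Fin (n + 2)) ≠ 0 := by simp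
    have hpred : (⟨m + 1, by omega⟩ : Fin (n + 2)).pred hne = ⟨m, by omega⟩ := by simp
    have hcs : ((⟨m, by omega⟩ : Fin (n + 1)).castSucc : Fin (n + 2)) = ⟨m, by omega⟩ := rfl
    have hsc : ((⟨m, by omega⟩ : Fin (n + 1)).succ : Fin (n + 2)) = ⟨m + 1, by omega⟩ := rfl
    simp only [ringDown, hne, dif_neg, not_false_eq_true, hpred, hcs, hsc]
    ring

/-- The downward bonds are strictly TP₂, positive, bounded, jointly measurable when `b`, `bc` are.
[ours] -/
theorem ringDown_props [LinearOrder X] (hbm : ∀ l, Measurable (uncurry (b l)))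
    (hbcm : Measurable (uncurry bc)) (hbpos : ∀ l v v', 0 < b l v v') (hbcpos : ∀ v v', 0 < bc v v')
    (hbbdd : ∀ l, ∃ C, ∀ v v', b l v v' ≤ C) (hbcbdd : ∃ C, ∀ v v', bc v v' ≤ C)
    (hbs : ∀ l u u' x y, u < u' → x < y → b l u y * b l u' x < b l u x * b l u' y)
    (hbcs : ∀ u u' x y, u < u' → x < y → bc u y * bc u' x < bc u x * bc u' y) (i : Fin (n + 2)) :
    (∀ x t, 0 < ringDown b bc i x t) ∧ Measurable (uncurry (ringDown b bc i)) ∧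
      (∃ C, ∀ x t, |ringDown b bc i x t| ≤ C) ∧
      ∀ x y t t', x < y → t < t' →
        ringDown b bc i x t' * ringDown b bc i y t < ringDown b bc i x t * ringDown b bc i y t' := by
  by_cases h : i = 0
  · subst h
    simp only [ringDown, dif_pos]
    obtain ⟨C, hC⟩ := hbcbdd
    refine ⟨fun x t => hbcpos t x, hbcm.comp measurable_swap, ⟨C, fun x t => ?_⟩, fun x y t t' hxy htt => ?_⟩
    · rw [abs_of_pos (hbcpos t x)]; exact hC t x
    · have := hbcs t t' x y htt hxy; linarith
  · simp only [ringDown, h, dif_neg, not_false_eq_true]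
    obtain ⟨C, hC⟩ := hbbdd (i.pred h)
    refine ⟨fun x t => hbpos _ t x, (hbm _).comp measurable_swap, ⟨C, fun x t => ?_⟩,
      fun x y t t' hxy htt => ?_⟩
    · rw [abs_of_pos (hbpos _ t x)]; exact hC t x
    · have := hbs (i.pred h) t t' x y htt hxy; linarith

end Ring

end Summit.Ventures.LatticeQCDFlow.Theory2.Autoregressive

end
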